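import Summits.CriticalPhenomena.Ising3DConformalLimit.Theses.ReflectionTwin
import Summits.CriticalPhenomena.Ising3DConformalLimit.Theses.HyperoctahedralRP
import HarnessLib
import HarnessLib.Audit

/-!
# Line `tree` — crux `TwinRotationGlue` (item stmt-CriticalPhenomena-16913, route `ReflectionTwin`, rank 5)

Crux workfile `Cruxes/TwinRotationGlue/Lines/tree.lean` (planner-cstrat-stmt-CriticalPhenomena-16913-b1-0,
crux-strategist before the lead, 2026-08-17).

## The technique with teeth: instantiate the nine-mirror isotropy theorem of route `HyperoctahedralRP`

The crux `ReflectionTwin.TwinRotationGlue` says: for every normalised, continuous-on-`NonCoincident`,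
non-degenerate, translation-invariant, scale-covariant pointwise limit `(ρ, Δ, S)` of `criticalCorr 3`, blind
transparency of the (111) reflection twin (some seam coupling `J`, some linear `A`) implies
`IsRotationInvariant S`.  Since 2026-08-16 the tree proves isotropy of EVERY such limit with NO continuity and
NO twin hypothesis — the solved sibling of exactly this step, in the same sub-problem:

* STUB 1 `stub_hrp2Rigidity : HyperoctahedralRP.HRP2Rigidity` — item stmt-CriticalPhenomena-1979, CLOSED
  `proved` by `Summit.CriticalPhenomena.Ising3DConformalLimit.Cruxes.HRP2Rigidity.XRayMellin.HRP2Rigidity_of`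
  (`Theorems/HyperoctahedralRPHRP2Rigidity.lean`, commit 34fd3613e614): a homogeneous positive kernel on `ℝ³ ∖ 0`
  of degree `−2Δ`, `Δ ∈ [1/2, 1]`, continuous, reflection positive w.r.t. the nine lattice mirrors of `B₃`, is
  `O(3)`-invariant (X-ray / Mellin axial symmetry + periodic-type Liouville).
* STUB 2 `stub_limitRotationInvariant : HyperoctahedralRP.LimitRotationInvariant` — item
  stmt-CriticalPhenomena-1980, CLOSED `proved` by
  `Summit.CriticalPhenomena.Ising3DConformalLimit.Cruxes.LimitRotationInvariant.QuarterTurnLiouville.LimitRotationInvariant_of`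
  (`Theorems/HyperoctahedralRPLimitRotationInvariant.lean`, commit b509d2f177bd):
  `HRP2Rigidity → ∀ (ρ, Δ, S), (H1)–(H6) → IsRotationInvariant S` (two-point kernel facts + crux stmt-8367
  `rotationUpgradeFromTwoPoint_proof`, also closed).

Both stubs are therefore discharged BY NAME by landed Theorems; this line has ZERO open stubs.  The Theorems are
deliberately NOT imported here (so the file is a genuine skeleton and the stub-vs-crux probes stay meaningful);
the closed version — this composition with the two theorem names substituted — is the crux workfile
`Cruxes/TwinRotationGlue/TreeProof.lean` (theorem `TreeProof.twinRotationGlue_of_tree : ReflectionTwin.TwinRotationGlue`,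
written by planner-skel-stmt-CriticalPhenomena-16913-0 and RE-VERIFIED by this seat on the farm 2026-08-17:
`lean check` rc 0, sorries 0, axioms `propext / Classical.choice / Quot.sound`, H21 audit `proof-of-item closed=true`
for `ReflectionTwin.TwinRotationGlue`).

TO CLOSE THE ITEM (lead prover, one proposal): copy `TreeProof.lean`'s theorem into
`Summits/CriticalPhenomena/Ising3DConformalLimit/Theorems/ReflectionTwinTwinRotationGlue.lean` and
`ledger propose --kind proof --target Summits/CriticalPhenomena/Ising3DConformalLimit/Theorems/ReflectionTwinTwinRotationGlue.lean
 --file ReflectionTwinTwinRotationGlue.lean --workitem stmt-CriticalPhenomena-16913`.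

COMPOSITION (`TwinRotationGlue_of`, kernel-checked, no `sorry` of its own): introduce the crux's `(ρ, Δ, S)`, its
seven hypotheses and the transparency witness; discard continuity and the witness; apply STUB 2 to STUB 1 and the
six remaining hypotheses.

DISPROOF USED.  No `Cruxes/TwinRotationGlue/Disproof.lean` exists (payload disproof_path absent on disk,
2026-08-17T08:3xZ); no `Negative/` lemma on any `ReflectionTwin` decl; `ledger negatives --problem CriticalPhenomena`
= 11 entries, none in `Ising3DConformalLimit`.  There is no `_false_without_<H>` obstruction to honour: the line
uses NONE of the crux's two extra hypotheses (continuity, twin transparency), which is legitimate because the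
conclusion already follows from (H1)–(H6).

RELATION TO LINE `birth`.  `Lines/birth.lean` (3 stubs = the route's own supports TwinReflectionSymmetry /
TwinTransfer / MirrorClosure, items 16908–16910, all OPEN) is the route's own mechanism; it remains valid and its
stubs remain route items (dividends), but for CLOSING THIS CRUX it is dominated by the present line (0 open stubs
versus 3).  See `Lines/tree.md` and `STRATEGY-CENSUS.md` (transfer / strengthen / decomposition / negation, and the
route-level consequence: once the crux closes this way, `TwinThreshold` and `TwinTransparency` no longer bear
load in `ReflectionTwin.closes`).

Sorries: exactly two, inside `stub_hrp2Rigidity` and `stub_limitRotationInvariant`.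
-/

noncomputable section

namespace Summit.CriticalPhenomena.Ising3DConformalLimit.Cruxes.TwinRotationGlue.Tree

open Literature.Probability.LatticeModels
open Summit.CriticalPhenomena.Ising3DConformalLimit.Theses

/-! ## The two registered stubs (the only `sorry`s of the file) — CLOSED items of route `HyperoctahedralRP` BY NAME -/

/-- **STUB 1 — `HyperoctahedralRP.HRP2Rigidity` (item stmt-CriticalPhenomena-1979, closed `proved`) BY NAME.**
Nine-mirror two-point rigidity: a continuous positive kernel on `ℝ³ ∖ 0`, homogeneous of degree `−2Δ` with
`Δ ∈ [1/2, 1]` and reflection positive with respect to the nine lattice mirror normals `{eᵢ, eᵢ ± eⱼ}`, is invariant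
under every linear isometry of `ℝ³`.  Discharge: `exact Cruxes.HRP2Rigidity.XRayMellin.HRP2Rigidity_of`
(`Theorems/HyperoctahedralRPHRP2Rigidity.lean`). [cite: DuminilCopinICM2022, §8.1 (8.1)–(8.3)] -/
theorem stub_hrp2Rigidity : HyperoctahedralRP.HRP2Rigidity := by
  sorry

/-- **STUB 2 — `HyperoctahedralRP.LimitRotationInvariant` (item stmt-CriticalPhenomena-1980, closed `proved`) BY NAME.**
Assuming `HRP2Rigidity`, every normalised, non-degenerate, translation-invariant, scale-covariant pointwise scaling
limit of `criticalCorr 3` is `O(3)`-invariant at all orders.  Discharge: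
`exact Cruxes.LimitRotationInvariant.QuarterTurnLiouville.LimitRotationInvariant_of`
(`Theorems/HyperoctahedralRPLimitRotationInvariant.lean`). [cite: DuminilCopinICM2022, §8.1 (8.1)–(8.3)] -/
theorem stub_limitRotationInvariant : HyperoctahedralRP.LimitRotationInvariant := by
  sorry

/-! ## The composition: the two stub signatures imply the crux, by name (real proof, no `sorry`) -/

/-- **THE SKELETON THEOREM** — `ReflectionTwin.TwinRotationGlue` from the two registered stub signatures
(`stub_hrp2Rigidity`, `stub_limitRotationInvariant`, in this order): the crux's continuity hypothesis and its
twin-transparency witness are discarded, and the sibling theorem is instantiated at `(ρ, Δ, S)`.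
[cite: DuminilCopinICM2022, §8.1 (8.1)–(8.3)] -/
theorem TwinRotationGlue_of (hA : HyperoctahedralRP.HRP2Rigidity)
    (hB : HyperoctahedralRP.LimitRotationInvariant) : ReflectionTwin.TwinRotationGlue := by
  intro ρ Δ S hρ hlim hnorm _hcont hnd htr hsc _hex
  exact hB hA ρ Δ S hρ hlim hnorm hnd htr hsc

end Summit.CriticalPhenomena.Ising3DConformalLimit.Cruxes.TwinRotationGlue.Tree

end
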